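import Summits.BirchSwinnertonDyer.BirchSwinnertonDyer.Theorems.PrintCFramBottomClassIndexLawFiveLeParitySplitPrimitivity
import Summits.BirchSwinnertonDyer.BirchSwinnertonDyer.Theorems.PrintCFramBottomClassIndexLawFiveLeLevelDictionaryStrictSelmer
import Summits.BirchSwinnertonDyer.BirchSwinnertonDyer.Theorems.PrintCFramBottomClassIndexLawFiveLeOffLocusTwistFactor
import Literature.NumberTheory.EllipticCurves.LFunctionSmulProofs
import Literature.NumberTheory.EllipticCurves.SzpiroOfAbcProofs
import Literature.NumberTheory.EllipticCurves.ComplexMultiplicationHasCMProofs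
import HarnessLib

/-!
# Crux `PrintCFram.BottomClassIndexLawFiveLe` (stmt-BirchSwinnertonDyer-20372), line `eisenstein-resource-bdp-line` (registry v19):
# THE FIELD-FACTOR DISCHARGE OF THE PRIMITIVITY SOCKET — a UNIT `K''`-factor `B_{1,(ψε_{K''}ω⁻¹)~}` makes the Heegner twist
# `p`-regular (`#Sel_p(W^{(d)}/ℚ) ≤ p`, `Ш(W^{(d)}/ℚ)[p] = 0`), so on the small-Selmer branch `BSD_p(W)` IS Heegner `p`-primitivity
# (cell `bsd-print-cfram`, width seat `bsd-line-cfram-p1-w3` g9; THEOREMS ONLY, `--supports` 20372; BSD is not proved by any of this)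

HONEST FRAMING. THEOREMS ONLY (0 defs / 0 facts / 0 sorry); nothing about BSD is proved unconditionally; no stub is closed; no summit
statement is proved by this seat; the crux C2 stays OPEN and is NOT claimed false. The glue w3 g8 named for its successor (HOME STATUS
2026-08-28T22:41:26Z (i)): w3 g8's socket `ParitySplit.bsdp_cmRamified_of_heegnerIndex_of_natCard_selmerGroup_le_pair` carries the «regular
twist» binder `#Sel^{(p)}(Wd/ℚ) ≤ p`; w6 g3's (α′) `LevelDictionaryAlpha.natCard_selmerGroup_le_of_unit_classFactor` proves that bound for every
class member with UNIT CLASS factor; w3 g7's `OffLocusTwistFactor.classFactor_twist_eq_fieldFactor` says the class factor of the Heegner twist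
`W^{(d_{K''})}` IS the `K''`-FACTOR `bernoulliOnePrim (bernoulliCharTwo ψ ε_{K''} ω)` of `(W, K'')` — the quantity Stub C makes a unit.
* §1 `hasCM_and_cmRamified_of_smul_quadraticTwist` (a model of a twist of a class member is a class member — same `j`);
  **`natCard_selmerGroup_le_of_unit_fieldFactor`** (unit field factor ⊢ `Nat.card (Wd.selmerGroup p) ≤ p` for any globally minimal
  `C • W.quadraticTwist d_K = Wd`); **`noPTorsion_twist_of_unit_fieldFactor`** (+ Cassels–Tate, GZK, `L(W^{(d_K)},1) ≠ 0` ⊢ `Ш(Wd/ℚ)[p] = 0`).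
* §2 the socket with its twist binder DISCHARGED (`…_of_natCard_selmerGroup_le_sq_of_unit_fieldFactor`) and the IFF (Ш-language, `.mpr` = the socket)
  `bsdp_iff_heegnerIndex_of_noPTorsion_of_unit_fieldFactor`:
  «B1 ∩ {Ш(W)[p] = 0} ⟸ admissible Heegner `K''` with UNIT field factor + `ord_p [W(K''):ℤP] = v_p(c)` + partner `BSD_p`» BY NAME.
* §3 on the Kriz–Li locus BOTH Selmer binders are discharged (`noPTorsion_of_unit_classFactor_of_analyticRank_one`):
  **`bsdp_iff_heegnerIndex_of_unit_classFactor_of_unit_fieldFactor`**, and in Kriz–Li's own currency — (4) as ONE product, split by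
  `p`-integrality (`BernoulliUnits.norm_bernoulliPair_le_one_of_hss`), for a datum of EITHER parity (rigidity `OffLocusDictionary.bernoulliFour_iff_of_hss`)
  — **`bsdp_iff_heegnerIndex_of_krizLiFour(_of_hss)`**: «(4) at an admissible Heegner `K''` ⟹ [`BSD_p(W)` ⟺ `ord_p [W(K''):ℤP] = v_p(c)`]»,
  Kriz–Li-FREE (no `p`-adic logarithm), from Gross–Zagier I.(6.3)/(7.3), Kolyvagin, GZK, modularity, Cassels–Tate and the partner's `BSD_p`
  (`hWd`; Burungale–Flach on the class via `EisensteinResourceBdpLine.rankZeroTwistBSDp_of_hasCM` — kept as a hypothesis: ROUTE-INDEPENDENT module).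

READING for the LEAD (v19): on the UNIT class-factor locus Stub C hands an admissible `K''` with unit field factor, and there the crux's
`BSD_p` is EQUIVALENT to Heegner `p`-primitivity up to Manin (the (KL) branch proves the left side from print); on B1 (NON-unit class factor)
the same socket (§2) takes such a `K''` as a SUPPLY hypothesis (Stub C's binders exclude B1) and «B1 ∩ small-Selmer = Heegner `p`-primitivity»
carries no Selmer-size binder on the twist. beyond-print theorem: NO (plumbing of landed sockets). CONDITIONAL on the named facts.
References: Gross–Zagier 1986 I.(6.3), V.§2; Kriz–Li 2019 Thm. 1.20, §2, §7.1; Bhargava–Skinner 2014 Lemma 16; Silverman AEC X.§4, X.5;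
Burungale–Flach 2024 Cor. 2; crux workfiles `Lines/eisenstein-resource-bdp-line-lead-g11.md` §5, `…-w6g3-notes.md`, `…-w3g7-notes.md`.
-/

set_option autoImplicit false
-- `…BirchSwinnertonDyer.BirchSwinnertonDyer.Theorems…` is the problem's mandated namespace (D-0017).
set_option linter.dupNamespace false

noncomputable section

open scoped Classical

namespace Summit.BirchSwinnertonDyer.BirchSwinnertonDyer.Theorems.PrintCFram.ParitySplit

open WeierstrassCurve NumberField IsDedekindDomain DirichletCharacter
  Literature.NumberTheory.EllipticCurves
  Literature.NumberTheory.EllipticCurves.ModularForms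
  Literature.NumberTheory.EllipticCurves.Rank1Residual
  Literature.NumberTheory.EllipticCurves.Rank1Residual.Typed
  Literature.NumberTheory.EllipticCurves.KrizLi2019
  Summit.BirchSwinnertonDyer.Rank1Residual
  Summit.BirchSwinnertonDyer.BirchSwinnertonDyer.Theorems
  Summit.BirchSwinnertonDyer.BirchSwinnertonDyer.Theorems.SchneiderFree
  Summit.BirchSwinnertonDyer.BirchSwinnertonDyer.Theorems.PrintCFram

/-! ## §1 A unit field factor makes the Heegner twist `p`-regular -/

/-- **A model of a twist of a class member is a class member.** For `W/ℚ` with CM and `p` ramified in its CM field, `d ≠ 0`, and any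
elliptic `Wd` with `C • W.quadraticTwist d = Wd`: `Wd` has CM and `CMRamified Wd p` — both predicates only see the `j`-invariant, and
`j(C • W^{(d)}) = j(W)` (`variableChange_j`, `j_quadraticTwist`, `hasCM_iff_of_j_eq`). [cite: SilvermanAEC2009, X.5 Cor. 5.4 and III.1 Prop. 1.4(b)] -/
theorem hasCM_and_cmRamified_of_smul_quadraticTwist (W : WeierstrassCurve ℚ) [W.IsElliptic] {p : ℕ}
    (hCM : W.HasCM) (hram : CMRamified W p) {d : ℚ} (hd : d ≠ 0)
    (Wd : WeierstrassCurve ℚ) [Wd.IsElliptic] (hC : ∃ C : VariableChange ℚ, C • W.quadraticTwist d = Wd) :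
    Wd.HasCM ∧ CMRamified Wd p := by
  obtain ⟨C, rfl⟩ := hC
  haveI := W.isElliptic_quadraticTwist hd
  have hj : (C • W.quadraticTwist d).j = W.j := by rw [variableChange_j, W.j_quadraticTwist hd]
  refine ⟨(hasCM_iff_of_j_eq hj).mpr hCM, ?_⟩
  unfold CMRamified at hram ⊢
  rw [hj]
  exact hram

/-- **`#Sel^{(p)}(Wd/ℚ) ≤ p` FROM A UNIT FIELD FACTOR.** Let `W/ℚ` be elliptic with CM, `p ≥ 5` ramified in the CM field, `(f, ψ, ω)` a
character datum with `ψ` ODD, `ω` Teichmüller and the trace congruence `a_ℓ(W) ≡ ψ(ℓ) + ψ⁻¹ω(ℓ)` at every prime `ℓ ∤ pN_W`; let `K` be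
imaginary quadratic with Kronecker character `ε_K` (`IsKroneckerCharacterOf`), and suppose the FIELD FACTOR of `(W, K)` is a UNIT,
`¬ ‖B_{1,(ψε_Kω⁻¹)~}‖_p ≤ p⁻¹` (`bernoulliOnePrim (bernoulliCharTwo ψ ε_K ω)`). Then every globally minimal model `Wd` of the twist
`W^{(d_K)}` has `#Sel^{(p)}(Wd/ℚ) ≤ p`. Proof: `Wd` is a class member (§1), so it carries its own odd datum `(f', ψ', ω')` with `hss`
(`OffLocusDictionary.exists_krizLiTriple_odd_of_cmRamified`); its class factor `B_{1,ψ'⁻¹}` EQUALS the field factor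
(`OffLocusTwistFactor.classFactor_twist_eq_fieldFactor`, transported along `LFunction_smul` / `conductorNorm_smul_rat`), hence is a unit;
and (α′) `LevelDictionaryAlpha.natCard_selmerGroup_le_of_unit_classFactor` bounds the Selmer group of a member with unit class factor.
[cite: KrizLi2019, Thm. 1.20 (p. 8), §2 (p. 11), §7.1 (p. 43)] [cite: BhargavaSkinner2014, proof of Lemma 16] [cite: SilvermanAEC2009, X.§4 (Cor. X.4.4) and X.5 Cor. 5.4] -/
theorem natCard_selmerGroup_le_of_unit_fieldFactor {p : ℕ} [Fact p.Prime]
    (W : WeierstrassCurve ℚ) [W.IsElliptic] (hCM : W.HasCM) (hram : CMRamified W p) (h5 : 5 ≤ p)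
    {f : ℕ} [NeZero f] (ψ : DirichletCharacter ℚ_[p] f) (ω : DirichletCharacter ℚ_[p] p)
    (hψ : ψ.Odd) (hω : IsTeichmullerCharacter ω)
    (hss : ∀ ℓ : ℕ, ℓ.Prime → ¬ (ℓ ∣ p * W.conductorNorm ℤ) →
      ‖((W.LFunction ℓ : ℤ) : ℚ_[p]) - (ψ (ℓ : ZMod f) + ψ⁻¹ (ℓ : ZMod f) * ω (ℓ : ZMod p))‖ < 1)
    (K : Type) [Field K] [NumberField K] (hK : IsImaginaryQuadratic K)
    (εK : DirichletCharacter ℚ_[p] (NumberField.discr K).natAbs) (hεK : IsKroneckerCharacterOf K εK)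
    (hfld : ¬ ‖bernoulliOnePrim (bernoulliCharTwo ψ εK ω)‖ ≤ (p : ℝ)⁻¹)
    (Wd : WeierstrassCurve ℚ) [Wd.IsElliptic] [Wd.IsGloballyMinimal]
    (hC : ∃ C : VariableChange ℚ, C • W.quadraticTwist (NumberField.discr K : ℚ) = Wd) :
    Nat.card (Wd.selmerGroup (p : ℤ)) ≤ p := by
  have hD0 : (NumberField.discr K : ℚ) ≠ 0 := by exact_mod_cast NumberField.discr_ne_zero K
  obtain ⟨hCMd, hramd⟩ := hasCM_and_cmRamified_of_smul_quadraticTwist W hCM hram hD0 Wd hC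
  -- the twist's own odd datum
  obtain ⟨f', hf', ψ', ω', -, -, hψ', hω', hss', -, -, -, -⟩ :=
    OffLocusDictionary.exists_krizLiTriple_odd_of_cmRamified Wd p hCMd hramd h5 K hK.1
  haveI := hf'
  -- the same datum read on the literal twist `W.quadraticTwist d_K` (`a_ℓ` and `N` are isomorphism invariants)
  obtain ⟨C, rfl⟩ := hC
  have hssX : ∀ ℓ : ℕ, ℓ.Prime → ¬ (ℓ ∣ p * (W.quadraticTwist (NumberField.discr K : ℚ)).conductorNorm ℤ) →
      ‖(((W.quadraticTwist (NumberField.discr K : ℚ)).LFunction ℓ : ℤ) : ℚ_[p]) -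
        (ψ' (ℓ : ZMod f') + ψ'⁻¹ (ℓ : ZMod f') * ω' (ℓ : ZMod p))‖ < 1 := by
    intro ℓ hℓ hℓN
    haveI := W.isElliptic_quadraticTwist hD0
    have hN : (C • W.quadraticTwist (NumberField.discr K : ℚ)).conductorNorm ℤ =
        (W.quadraticTwist (NumberField.discr K : ℚ)).conductorNorm ℤ :=
      conductorNorm_smul_rat (W.quadraticTwist (NumberField.discr K : ℚ)) C
    have hL : (C • W.quadraticTwist (NumberField.discr K : ℚ)).LFunction =
        (W.quadraticTwist (NumberField.discr K : ℚ)).LFunction :=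
      LFunction_smul (W.quadraticTwist (NumberField.discr K : ℚ)) C
    have h := hss' ℓ hℓ (by rw [hN]; exact hℓN)
    rw [hL] at h
    exact h
  -- the twist's class factor is the field factor, a unit
  have hcls' : ¬ ‖bernoulliOnePrim ψ'⁻¹‖ ≤ (p : ℝ)⁻¹ := by
    rw [OffLocusTwistFactor.classFactor_twist_eq_fieldFactor W h5 ψ ω hψ hω hss K hK εK hεK ψ' ω' hψ' hω' hssX]
    exact hfld
  -- (α′)
  exact LevelDictionaryAlpha.natCard_selmerGroup_le_of_unit_classFactor _ p hCMd hramd h5 ψ' ω' hψ' hω' hss' hcls'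

/-- **`Ш(Wd/ℚ)[p] = 0` FROM A UNIT FIELD FACTOR** (the «regular twist» binder of the socket): with the data of
`natCard_selmerGroup_le_of_unit_fieldFactor` and `L(W^{(d_K)},1) ≠ 0` (so `r_an(Wd) = 0`), granting the Cassels–Tate pairing and GZK,
`#Sel^{(p)}(Wd/ℚ) ≤ p` forces `Ш(Wd/ℚ)[p] = 0` (`noPTorsion_of_natCard_selmerGroup_le_of_analyticRank_zero`).
[cite: Cassels1962ArithmeticIV] [cite: SilvermanAEC2009, Thm X.4.14 and Thm X.4.2] [cite: KrizLi2019, Thm. 1.20 (p. 8) and §7.1 (p. 43)] -/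
theorem noPTorsion_twist_of_unit_fieldFactor {p : ℕ} [Fact p.Prime]
    (hCT : exists_casselsTate_pairing (K := ℚ)) (hGZK : rank_eq_analyticRank_of_analyticRank_le_one)
    (W : WeierstrassCurve ℚ) [W.IsElliptic] (hCM : W.HasCM) (hram : CMRamified W p) (h5 : 5 ≤ p)
    {f : ℕ} [NeZero f] (ψ : DirichletCharacter ℚ_[p] f) (ω : DirichletCharacter ℚ_[p] p)
    (hψ : ψ.Odd) (hω : IsTeichmullerCharacter ω)
    (hss : ∀ ℓ : ℕ, ℓ.Prime → ¬ (ℓ ∣ p * W.conductorNorm ℤ) →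
      ‖((W.LFunction ℓ : ℤ) : ℚ_[p]) - (ψ (ℓ : ZMod f) + ψ⁻¹ (ℓ : ZMod f) * ω (ℓ : ZMod p))‖ < 1)
    (K : Type) [Field K] [NumberField K] (hK : IsImaginaryQuadratic K)
    (εK : DirichletCharacter ℚ_[p] (NumberField.discr K).natAbs) (hεK : IsKroneckerCharacterOf K εK)
    (hfld : ¬ ‖bernoulliOnePrim (bernoulliCharTwo ψ εK ω)‖ ≤ (p : ℝ)⁻¹)
    (Wd : WeierstrassCurve ℚ) [Wd.IsElliptic] [Wd.IsGloballyMinimal]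
    (hC : ∃ C : VariableChange ℚ, C • W.quadraticTwist (NumberField.discr K : ℚ) = Wd)
    (hLt : (W.quadraticTwist (NumberField.discr K : ℚ)).entireLFunction 1 ≠ 0) :
    ∀ x : Wd.sha, (p : ℤ) • x = 0 → x = 0 := by
  have hseld := natCard_selmerGroup_le_of_unit_fieldFactor W hCM hram h5 ψ ω hψ hω hss K hK εK hεK hfld Wd hC
  obtain ⟨C, hCd⟩ := hC
  have hD0 : (NumberField.discr K : ℚ) ≠ 0 := by exact_mod_cast NumberField.discr_ne_zero K
  haveI : (W.quadraticTwist (NumberField.discr K : ℚ)).IsElliptic := W.isElliptic_quadraticTwist hD0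
  have hLd1 : Wd.entireLFunction 1 ≠ 0 := by rw [← hCd, entireLFunction_smul]; exact hLt
  have hrd : Wd.analyticRank = 0 := analyticRank_eq_zero_of_entireLFunction_one_ne_zero Wd hLd1
  exact noPTorsion_of_natCard_selmerGroup_le_of_analyticRank_zero Wd p hCT hGZK hrd hseld

/-! ## §2 The primitivity socket with the twist binder discharged by a unit field factor -/

/-- **PRIMITIVITY SOCKET, FIELD-FACTOR FORM.** For a class member (`W/ℚ` globally minimal with CM, `p ≥ 5` CM-ramified, `r_an(W) = 1`) with an
odd datum `(f, ψ, ω)` (`hss`), ON THE BRANCH `#Sel^{(p)}(W/ℚ) ≤ p²` (⟺ `Ш(W)[p] = 0` in rank one, `ParitySplit.natCard_selmerGroup_le_sq_iff_noPTorsion`),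
an imaginary quadratic `K` Heegner for `N_W` (`d_K` odd `< −4`, `L(W^{(d_K)},1) ≠ 0`), its Kronecker `ε_K` with UNIT FIELD FACTOR, the Heegner point `P`
of `Dt` (constant `c`) and any minimal model `Wd` of the twist with `BSD_p(Wd)`: `ord_p [W(K):ℤP] = v_p(c)` ⟹ `BSD_p(W)` — w3 g8's
`bsdp_cmRamified_of_heegnerIndex_of_natCard_selmerGroup_le_pair` with its twist binder `#Sel^{(p)}(Wd/ℚ) ≤ p` DISCHARGED by §1 from the
unit field factor. «B1 ∩ small-Selmer ⟸ admissible Heegner field with unit field factor + Heegner `p`-primitivity + partner `BSD_p`»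
BY NAME. CONDITIONAL on the named facts; closes no stub. [cite: Cassels1962ArithmeticIV] [cite: GrossZagier1986, Thm. I.(6.3) and V.§2 (pp. 310–312)]
[cite: BurungaleFlach2024, Thm. 1.1 and Cor. 2] [cite: KrizLi2019, Thm. 1.20 (p. 8) and §7.1 (p. 43)] -/
theorem bsdp_cmRamified_of_heegnerIndex_of_natCard_selmerGroup_le_sq_of_unit_fieldFactor {p : ℕ} [Fact p.Prime]
    (hGZ : ∀ (N : ℕ) [NeZero N] (W : WeierstrassCurve ℚ) (K : Type) [Field K] [NumberField K], gross_zagier N W K)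
    (hKo : ∀ (N : ℕ) [NeZero N] (W : WeierstrassCurve ℚ) (K : Type) [Field K] [NumberField K], kolyvagin N W K)
    (hGZK : rank_eq_analyticRank_of_analyticRank_le_one) (hmod : hasEntireLFunction_rat) (hGZ73 : GrossZagier1986_thm_I_7_3)
    (hCT : exists_casselsTate_pairing (K := ℚ))
    (W : WeierstrassCurve ℚ) [W.IsElliptic] [W.IsGloballyMinimal] (hCM : W.HasCM) (hram : CMRamified W p) (h5 : 5 ≤ p)
    (hr : W.analyticRank = 1)
    {f : ℕ} [NeZero f] (ψ : DirichletCharacter ℚ_[p] f) (ω : DirichletCharacter ℚ_[p] p)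
    (hψ : ψ.Odd) (hω : IsTeichmullerCharacter ω)
    (hss : ∀ ℓ : ℕ, ℓ.Prime → ¬ (ℓ ∣ p * W.conductorNorm ℤ) →
      ‖((W.LFunction ℓ : ℤ) : ℚ_[p]) - (ψ (ℓ : ZMod f) + ψ⁻¹ (ℓ : ZMod f) * ω (ℓ : ZMod p))‖ < 1)
    (N : ℕ) [NeZero N] (K : Type) [Field K] [NumberField K]
    (Dt : ModularParametrizationData W N) (H : HeegnerDatum N (NumberField.discr K)) (ι : K →+* ℂ)
    (P : (W.baseChange K).toAffine.Point) (Wd : WeierstrassCurve ℚ) [Wd.IsElliptic] [Wd.IsGloballyMinimal]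
    (hN : W.conductorNorm ℤ = N) (hK : IsImaginaryQuadratic K) (hHN : SatisfiesHeegnerHypothesis N K)
    (hodd : Odd (NumberField.discr K)) (hd4 : NumberField.discr K < -4)
    (hLt : (W.quadraticTwist (NumberField.discr K : ℚ)).entireLFunction 1 ≠ 0)
    (hP : WeierstrassCurve.Affine.Point.map ι.toRatAlgHom P = heegnerPointComplex Dt H)
    (hC : ∃ C : VariableChange ℚ, C • W.quadraticTwist (NumberField.discr K : ℚ) = Wd)
    (εK : DirichletCharacter ℚ_[p] (NumberField.discr K).natAbs) (hεK : IsKroneckerCharacterOf K εK)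
    (hfld : ¬ ‖bernoulliOnePrim (bernoulliCharTwo ψ εK ω)‖ ≤ (p : ℝ)⁻¹)
    (hsel : Nat.card (W.selmerGroup (p : ℤ)) ≤ p ^ 2)
    (hidx : padicValNat p (AddSubgroup.zmultiples P).index = padicValNat p Dt.c.natAbs) (hWd : BSDp Wd p) :
    BSDp W p :=
  bsdp_cmRamified_of_heegnerIndex_of_natCard_selmerGroup_le_pair hGZ hKo hGZK hmod hGZ73 hCT W hCM hram h5 hr N K Dt H ι P Wd hN hK
    hHN hodd hd4 hLt hP hC hsel (natCard_selmerGroup_le_of_unit_fieldFactor W hCM hram h5 ψ ω hψ hω hss K hK εK hεK hfld Wd hC) hidx hWd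

/-- **THE IFF, FIELD-FACTOR FORM.** For a class member with `r_an(W) = 1` on the branch `Ш(W)[p] = 0`, an admissible Heegner `K` (`d_K` odd
`< −4`, `L(W^{(d_K)},1) ≠ 0`) whose FIELD FACTOR for the class's odd datum is a UNIT, the Heegner point `P` of `Dt`, and a minimal model `Wd`
of the twist with `BSD_p(Wd)`: **`BSDp W p ↔ ord_p [W(K):ℤP] = v_p(c)`** — w3 g8's `bsdp_iff_heegnerIndex_cmRamified` with its binder
`Ш(Wd)[p] = 0` DISCHARGED by §1. Inputs: the five `ToricPublishedInputs` binders, Cassels–Tate, the partner's `BSD_p`. CONDITIONAL; closes no stub.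
[cite: GrossZagier1986, Thm. I.(6.3) and V.§2 (pp. 310–312)] [cite: BurungaleFlach2024, Thm. 1.1 and Cor. 2] [cite: KrizLi2019, Thm. 1.20 (p. 8) and §7.1 (p. 43)] -/
theorem bsdp_iff_heegnerIndex_of_noPTorsion_of_unit_fieldFactor {p : ℕ} [Fact p.Prime]
    (hGZ : ∀ (N : ℕ) [NeZero N] (W : WeierstrassCurve ℚ) (K : Type) [Field K] [NumberField K], gross_zagier N W K)
    (hKo : ∀ (N : ℕ) [NeZero N] (W : WeierstrassCurve ℚ) (K : Type) [Field K] [NumberField K], kolyvagin N W K)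
    (hGZK : rank_eq_analyticRank_of_analyticRank_le_one) (hmod : hasEntireLFunction_rat) (hGZ73 : GrossZagier1986_thm_I_7_3)
    (hCT : exists_casselsTate_pairing (K := ℚ))
    (W : WeierstrassCurve ℚ) [W.IsElliptic] [W.IsGloballyMinimal] (hCM : W.HasCM) (hram : CMRamified W p) (h5 : 5 ≤ p)
    (hr : W.analyticRank = 1)
    {f : ℕ} [NeZero f] (ψ : DirichletCharacter ℚ_[p] f) (ω : DirichletCharacter ℚ_[p] p)
    (hψ : ψ.Odd) (hω : IsTeichmullerCharacter ω)
    (hss : ∀ ℓ : ℕ, ℓ.Prime → ¬ (ℓ ∣ p * W.conductorNorm ℤ) →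
      ‖((W.LFunction ℓ : ℤ) : ℚ_[p]) - (ψ (ℓ : ZMod f) + ψ⁻¹ (ℓ : ZMod f) * ω (ℓ : ZMod p))‖ < 1)
    (N : ℕ) [NeZero N] (K : Type) [Field K] [NumberField K]
    (Dt : ModularParametrizationData W N) (H : HeegnerDatum N (NumberField.discr K)) (ι : K →+* ℂ)
    (P : (W.baseChange K).toAffine.Point) (Wd : WeierstrassCurve ℚ) [Wd.IsElliptic] [Wd.IsGloballyMinimal]
    (hN : W.conductorNorm ℤ = N) (hK : IsImaginaryQuadratic K) (hHN : SatisfiesHeegnerHypothesis N K)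
    (hodd : Odd (NumberField.discr K)) (hd4 : NumberField.discr K < -4)
    (hLt : (W.quadraticTwist (NumberField.discr K : ℚ)).entireLFunction 1 ≠ 0)
    (hP : WeierstrassCurve.Affine.Point.map ι.toRatAlgHom P = heegnerPointComplex Dt H)
    (hC : ∃ C : VariableChange ℚ, C • W.quadraticTwist (NumberField.discr K : ℚ) = Wd)
    (εK : DirichletCharacter ℚ_[p] (NumberField.discr K).natAbs) (hεK : IsKroneckerCharacterOf K εK)
    (hfld : ¬ ‖bernoulliOnePrim (bernoulliCharTwo ψ εK ω)‖ ≤ (p : ℝ)⁻¹)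
    (h0 : ∀ x : W.sha, (p : ℤ) • x = 0 → x = 0) (hWd : BSDp Wd p) :
    BSDp W p ↔ padicValNat p (AddSubgroup.zmultiples P).index = padicValNat p Dt.c.natAbs :=
  bsdp_iff_heegnerIndex_cmRamified hGZ hKo hGZK hmod hGZ73 W hCM hram h5 hr N K Dt H ι P Wd hN hK hHN hodd hd4 hLt hP hC h0
    (noPTorsion_twist_of_unit_fieldFactor hCT hGZK W hCM hram h5 ψ ω hψ hω hss K hK εK hεK hfld Wd hC hLt) hWd

/-! ## §3 On the Kriz–Li locus: both Selmer binders discharged -/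

/-- **`Ш(W/ℚ)[p] = 0` on the Kriz–Li locus in analytic rank one.** For a class member (`W/ℚ` globally minimal with CM, `p ≥ 5` CM-ramified)
with `r_an(W) = 1` and an odd datum `(f, ψ, ω)` (`hss`) whose CLASS FACTOR is a UNIT (`¬ ‖B_{1,ψ⁻¹}‖ ≤ p⁻¹`), granting Cassels–Tate and GZK:
`Ш(W/ℚ)[p] = 0` — (α′) `LevelDictionaryAlpha.natCard_selmerGroup_le_of_unit_classFactor` gives `#Sel_p(W/ℚ) ≤ p = p^k`, `k ≤ 1 < rank + 2`,
and `X11b.noPTorsion_of_card_selmerGroup_lt_of_casselsTate`. (w6 g3's companion `sha_torsion_eq_zero_of_unit_classFactor` is the CT-free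
form from a non-`p`-divisible rational point.) [cite: Cassels1962ArithmeticIV] [cite: BhargavaSkinner2014, proof of Lemma 16] [cite: SilvermanAEC2009, Thm X.4.14 and Thm X.4.2] -/
theorem noPTorsion_of_unit_classFactor_of_analyticRank_one {p : ℕ} [hp : Fact p.Prime]
    (hCT : exists_casselsTate_pairing (K := ℚ)) (hGZK : rank_eq_analyticRank_of_analyticRank_le_one)
    (W : WeierstrassCurve ℚ) [W.IsElliptic] [W.IsGloballyMinimal] (hCM : W.HasCM) (hram : CMRamified W p) (h5 : 5 ≤ p)
    (hr : W.analyticRank = 1)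
    {f : ℕ} [NeZero f] (ψ : DirichletCharacter ℚ_[p] f) (ω : DirichletCharacter ℚ_[p] p)
    (hψ : ψ.Odd) (hω : IsTeichmullerCharacter ω)
    (hss : ∀ ℓ : ℕ, ℓ.Prime → ¬ (ℓ ∣ p * W.conductorNorm ℤ) →
      ‖((W.LFunction ℓ : ℤ) : ℚ_[p]) - (ψ (ℓ : ZMod f) + ψ⁻¹ (ℓ : ZMod f) * ω (ℓ : ZMod p))‖ < 1)
    (hcls : ¬ ‖bernoulliOnePrim ψ⁻¹‖ ≤ (p : ℝ)⁻¹) :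
    ∀ x : W.sha, (p : ℤ) • x = 0 → x = 0 := by
  obtain ⟨hrank, hfin⟩ := hGZK W hr.le
  haveI : Finite W.sha := hfin
  obtain ⟨k, hk⟩ := exists_natCard_selmerGroup_eq_pow W p
  have hselW := LevelDictionaryAlpha.natCard_selmerGroup_le_of_unit_classFactor W p hCM hram h5 ψ ω hψ hω hss hcls
  have hk1 : k ≤ 1 := by
    rw [hk] at hselW
    exact (Nat.pow_le_pow_iff_right hp.out.one_lt).mp (by simpa only [pow_one] using hselW)
  exact X11b.noPTorsion_of_card_selmerGroup_lt_of_casselsTate W hCT p hk (by rw [hrank, hr]; omega)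

/-- **THE IFF ON THE KRIZ–LI LOCUS: unit CLASS factor and unit FIELD factor ⟹ [`BSD_p(W)` ⟺ Heegner `p`-primitivity up to Manin].** For a
class member (`W/ℚ` globally minimal with CM, `p ≥ 5` CM-ramified, `r_an(W) = 1`), an odd datum `(f, ψ, ω)` with `hss` and UNIT class factor,
an admissible Heegner `K` (`d_K` odd `< −4`, `L(W^{(d_K)},1) ≠ 0`) with Kronecker `ε_K` and UNIT field factor, the Heegner point `P` of `Dt`
(constant `c`) and any minimal model `Wd` of the twist with `BSD_p(Wd)`: **`BSDp W p ↔ ord_p [W(K):ℤP] = v_p(c)`**. Both Selmer binders of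
w3 g8's `bsdp_iff_heegnerIndex_cmRamified` are DISCHARGED (`Ш(W)[p] = 0` by `noPTorsion_of_unit_classFactor_of_analyticRank_one`, `Ш(Wd)[p] = 0`
by §1). Kriz–Li-FREE (no `p`-adic logarithm): inputs Gross–Zagier I.(6.3)/(7.3), Kolyvagin, GZK, modularity, Cassels–Tate, the partner's `BSD_p`.
CONDITIONAL; closes no stub; BSD is not proved by any of this. [cite: GrossZagier1986, Thm. I.(6.3) and V.§2 (pp. 310–312)]
[cite: KrizLi2019, Thm. 1.20 (pp. 7–8) and §7.1 (p. 43)] [cite: BurungaleFlach2024, Thm. 1.1 and Cor. 2] [cite: Cassels1962ArithmeticIV] -/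
theorem bsdp_iff_heegnerIndex_of_unit_classFactor_of_unit_fieldFactor {p : ℕ} [Fact p.Prime]
    (hGZ : ∀ (N : ℕ) [NeZero N] (W : WeierstrassCurve ℚ) (K : Type) [Field K] [NumberField K], gross_zagier N W K)
    (hKo : ∀ (N : ℕ) [NeZero N] (W : WeierstrassCurve ℚ) (K : Type) [Field K] [NumberField K], kolyvagin N W K)
    (hGZK : rank_eq_analyticRank_of_analyticRank_le_one) (hmod : hasEntireLFunction_rat) (hGZ73 : GrossZagier1986_thm_I_7_3)
    (hCT : exists_casselsTate_pairing (K := ℚ))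
    (W : WeierstrassCurve ℚ) [W.IsElliptic] [W.IsGloballyMinimal] (hCM : W.HasCM) (hram : CMRamified W p) (h5 : 5 ≤ p)
    (hr : W.analyticRank = 1)
    {f : ℕ} [NeZero f] (ψ : DirichletCharacter ℚ_[p] f) (ω : DirichletCharacter ℚ_[p] p)
    (hψ : ψ.Odd) (hω : IsTeichmullerCharacter ω)
    (hss : ∀ ℓ : ℕ, ℓ.Prime → ¬ (ℓ ∣ p * W.conductorNorm ℤ) →
      ‖((W.LFunction ℓ : ℤ) : ℚ_[p]) - (ψ (ℓ : ZMod f) + ψ⁻¹ (ℓ : ZMod f) * ω (ℓ : ZMod p))‖ < 1)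
    (hcls : ¬ ‖bernoulliOnePrim ψ⁻¹‖ ≤ (p : ℝ)⁻¹)
    (N : ℕ) [NeZero N] (K : Type) [Field K] [NumberField K]
    (Dt : ModularParametrizationData W N) (H : HeegnerDatum N (NumberField.discr K)) (ι : K →+* ℂ)
    (P : (W.baseChange K).toAffine.Point) (Wd : WeierstrassCurve ℚ) [Wd.IsElliptic] [Wd.IsGloballyMinimal]
    (hN : W.conductorNorm ℤ = N) (hK : IsImaginaryQuadratic K) (hHN : SatisfiesHeegnerHypothesis N K)
    (hodd : Odd (NumberField.discr K)) (hd4 : NumberField.discr K < -4)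
    (hLt : (W.quadraticTwist (NumberField.discr K : ℚ)).entireLFunction 1 ≠ 0)
    (hP : WeierstrassCurve.Affine.Point.map ι.toRatAlgHom P = heegnerPointComplex Dt H)
    (hC : ∃ C : VariableChange ℚ, C • W.quadraticTwist (NumberField.discr K : ℚ) = Wd)
    (εK : DirichletCharacter ℚ_[p] (NumberField.discr K).natAbs) (hεK : IsKroneckerCharacterOf K εK)
    (hfld : ¬ ‖bernoulliOnePrim (bernoulliCharTwo ψ εK ω)‖ ≤ (p : ℝ)⁻¹) (hWd : BSDp Wd p) :
    BSDp W p ↔ padicValNat p (AddSubgroup.zmultiples P).index = padicValNat p Dt.c.natAbs :=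
  bsdp_iff_heegnerIndex_of_noPTorsion_of_unit_fieldFactor hGZ hKo hGZK hmod hGZ73 hCT W hCM hram h5 hr ψ ω hψ hω hss N K Dt H ι P Wd hN
    hK hHN hodd hd4 hLt hP hC εK hεK hfld (noPTorsion_of_unit_classFactor_of_analyticRank_one hCT hGZK W hCM hram h5 hr ψ ω hψ hω hss hcls)
    hWd

/-- **KRIZ–LI'S HYPOTHESIS (4) ⟹ [`BSD_p(W)` ⟺ HEEGNER `p`-PRIMITIVITY UP TO MANIN] — in Kriz–Li's own currency.** For a class member
(`W/ℚ` globally minimal with CM, `p ≥ 5` CM-ramified, `r_an(W) = 1`), an odd datum `(f, ψ, ω)` with `hss`, an admissible Heegner `K` for `N_W`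
(`d_K` odd `< −4`, `L(W^{(d_K)},1) ≠ 0`) with Kronecker character `ε_K`, and Thm. 1.20's hypothesis (4) AS PRINTED,
`B_{1,ψ₀⁻¹ε_K}·B_{1,ψ₀ω⁻¹} ≢ 0 (mod p)` (`¬ ‖bernoulliOnePrim (bernoulliCharOne ψ ε_K) * bernoulliOnePrim (bernoulliCharTwo ψ ε_K ω)‖ ≤ p⁻¹`):
for the Heegner point `P` of `Dt` and any minimal model `Wd` of the twist with `BSD_p(Wd)`, **`BSDp W p ↔ ord_p [W(K):ℤP] = v_p(c)`**. Both
Bernoulli numbers are `p`-integral on the class (`BernoulliUnits.norm_bernoulliPair_le_one_of_hss`, `p ∤ d_K` as `p ∣ N_W` splits in `K`), so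
(4) splits into a unit class factor `B_{1,ψ⁻¹}` (`RegularLocusBernoulliPair.bernoulliOnePrim_bernoulliCharOne_of_not_even`) and a unit field
factor; then `bsdp_iff_heegnerIndex_of_unit_classFactor_of_unit_fieldFactor`. NO `p`-adic logarithm, NO Thm 1.20: on the Kriz–Li locus the
ALGEBRAIC side is rigid and the crux's `BSD_p` is exactly the `p`-part of the Gross–Zagier index. CONDITIONAL; closes no stub.
[cite: KrizLi2019, Thm. 1.20 (pp. 7–8), §2 (pp. 11–12), §7.1 (p. 43), Cor. 8.4] [cite: GrossZagier1986, Thm. I.(6.3) and V.§2 (pp. 310–312)]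
[cite: BurungaleFlach2024, Thm. 1.1 and Cor. 2] [cite: Cassels1962ArithmeticIV] -/
theorem bsdp_iff_heegnerIndex_of_krizLiFour {p : ℕ} [hp : Fact p.Prime]
    (hGZ : ∀ (N : ℕ) [NeZero N] (W : WeierstrassCurve ℚ) (K : Type) [Field K] [NumberField K], gross_zagier N W K)
    (hKo : ∀ (N : ℕ) [NeZero N] (W : WeierstrassCurve ℚ) (K : Type) [Field K] [NumberField K], kolyvagin N W K)
    (hGZK : rank_eq_analyticRank_of_analyticRank_le_one) (hmod : hasEntireLFunction_rat) (hGZ73 : GrossZagier1986_thm_I_7_3)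
    (hCT : exists_casselsTate_pairing (K := ℚ))
    (W : WeierstrassCurve ℚ) [W.IsElliptic] [W.IsGloballyMinimal] (hCM : W.HasCM) (hram : CMRamified W p) (h5 : 5 ≤ p)
    (hr : W.analyticRank = 1)
    {f : ℕ} [NeZero f] (ψ : DirichletCharacter ℚ_[p] f) (ω : DirichletCharacter ℚ_[p] p)
    (hψ : ψ.Odd) (hω : IsTeichmullerCharacter ω)
    (hss : ∀ ℓ : ℕ, ℓ.Prime → ¬ (ℓ ∣ p * W.conductorNorm ℤ) →
      ‖((W.LFunction ℓ : ℤ) : ℚ_[p]) - (ψ (ℓ : ZMod f) + ψ⁻¹ (ℓ : ZMod f) * ω (ℓ : ZMod p))‖ < 1)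
    (N : ℕ) [NeZero N] (K : Type) [Field K] [NumberField K]
    (Dt : ModularParametrizationData W N) (H : HeegnerDatum N (NumberField.discr K)) (ι : K →+* ℂ)
    (P : (W.baseChange K).toAffine.Point) (Wd : WeierstrassCurve ℚ) [Wd.IsElliptic] [Wd.IsGloballyMinimal]
    (hN : W.conductorNorm ℤ = N) (hK : IsImaginaryQuadratic K) (hHN : SatisfiesHeegnerHypothesis N K)
    (hodd : Odd (NumberField.discr K)) (hd4 : NumberField.discr K < -4)
    (hLt : (W.quadraticTwist (NumberField.discr K : ℚ)).entireLFunction 1 ≠ 0)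
    (hP : WeierstrassCurve.Affine.Point.map ι.toRatAlgHom P = heegnerPointComplex Dt H)
    (hC : ∃ C : VariableChange ℚ, C • W.quadraticTwist (NumberField.discr K : ℚ) = Wd)
    (εK : DirichletCharacter ℚ_[p] (NumberField.discr K).natAbs) (hεK : IsKroneckerCharacterOf K εK)
    (h4 : ¬ ‖bernoulliOnePrim (bernoulliCharOne ψ εK) * bernoulliOnePrim (bernoulliCharTwo ψ εK ω)‖ ≤ (p : ℝ)⁻¹)
    (hWd : BSDp Wd p) :
    BSDp W p ↔ padicValNat p (AddSubgroup.zmultiples P).index = padicValNat p Dt.c.natAbs := by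
  have hpp : p.Prime := hp.out
  have hp2 : p ≠ 2 := by omega
  -- `p ∣ N_W` (additive CM-ramified prime) splits in `K`, so `p ∤ d_K`
  have hpN : p ∣ N := by
    rw [← hN]
    exact (W.dvd_conductorNorm_iff_not_hasGoodReductionAtPrime p).mpr (X12.not_good_of_cmRamified W p hCM hp2 hram)
  have hpd : ¬ (p : ℤ) ∣ NumberField.discr K :=
    X11b.Three.not_dvd_discr_of_ncard_primesOver_eq_two hK.1 hp2 (hHN p hpp hpN)
  have hpd' : ¬ p ∣ (NumberField.discr K).natAbs := fun h ↦ hpd (Int.natCast_dvd.mpr h)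
  haveI : NeZero (NumberField.discr K).natAbs := ⟨Int.natAbs_ne_zero.mpr (NumberField.discr_ne_zero K)⟩
  -- both Bernoulli numbers are `p`-integral; (4) splits
  obtain ⟨ha, hb⟩ := BernoulliUnits.norm_bernoulliPair_le_one_of_hss W hCM hram h5 hω ψ hss εK hpd'
  have hne : ¬ ψ.Even := EisensteinPair.not_even_of_odd' ψ hψ
  rw [RegularLocusBernoulliPair.bernoulliOnePrim_bernoulliCharOne_of_not_even ψ εK hne] at ha h4
  have hp0 : (0 : ℝ) ≤ (p : ℝ)⁻¹ := by positivity
  have hcls : ¬ ‖bernoulliOnePrim ψ⁻¹‖ ≤ (p : ℝ)⁻¹ := fun h ↦ h4 (by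
    rw [norm_mul]
    calc ‖bernoulliOnePrim ψ⁻¹‖ * ‖bernoulliOnePrim (bernoulliCharTwo ψ εK ω)‖
        ≤ (p : ℝ)⁻¹ * 1 := mul_le_mul h hb (norm_nonneg _) hp0
      _ = (p : ℝ)⁻¹ := mul_one _)
  have hfld : ¬ ‖bernoulliOnePrim (bernoulliCharTwo ψ εK ω)‖ ≤ (p : ℝ)⁻¹ := fun h ↦ h4 (by
    rw [norm_mul]
    calc ‖bernoulliOnePrim ψ⁻¹‖ * ‖bernoulliOnePrim (bernoulliCharTwo ψ εK ω)‖
        ≤ 1 * (p : ℝ)⁻¹ := mul_le_mul ha h (norm_nonneg _) zero_le_one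
      _ = (p : ℝ)⁻¹ := one_mul _)
  exact bsdp_iff_heegnerIndex_of_unit_classFactor_of_unit_fieldFactor hGZ hKo hGZK hmod hGZ73 hCT W hCM hram h5 hr ψ ω hψ hω hss hcls
    N K Dt H ι P Wd hN hK hHN hodd hd4 hLt hP hC εK hεK hfld hWd

/-- **(4) FOR ANY DATUM, EITHER PARITY.** The same as `bsdp_iff_heegnerIndex_of_krizLiFour` for an ARBITRARY character datum `(f, ψ, ω)`
with `hss` (ψ odd OR even — Kriz–Li's (4) is symmetric under the swap `ψ ↔ ψ⁻¹ω`, and RIGID: it holds for one admissible triple at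
`(W, p, K)` iff for all, `OffLocusDictionary.bernoulliFour_iff_of_hss`); the proof moves (4) to the class's ODD triple
(`OffLocusDictionary.exists_krizLiTriple_odd_of_cmRamified`). So for EVERY Kriz–Li datum of the composition's (KL) branch at an admissible
`K` with `d_K` odd `< −4`: **`BSDp W p ↔ ord_p [W(K):ℤP] = v_p(c)`**, Kriz–Li-free. CONDITIONAL; closes no stub; BSD is not proved by any of this.
[cite: KrizLi2019, Thm. 1.20 (pp. 7–8), §7.1 (p. 43)] [cite: GrossZagier1986, Thm. I.(6.3) and V.§2 (pp. 310–312)] [cite: Cassels1962ArithmeticIV] -/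
theorem bsdp_iff_heegnerIndex_of_krizLiFour_of_hss {p : ℕ} [hp : Fact p.Prime]
    (hGZ : ∀ (N : ℕ) [NeZero N] (W : WeierstrassCurve ℚ) (K : Type) [Field K] [NumberField K], gross_zagier N W K)
    (hKo : ∀ (N : ℕ) [NeZero N] (W : WeierstrassCurve ℚ) (K : Type) [Field K] [NumberField K], kolyvagin N W K)
    (hGZK : rank_eq_analyticRank_of_analyticRank_le_one) (hmod : hasEntireLFunction_rat) (hGZ73 : GrossZagier1986_thm_I_7_3)
    (hCT : exists_casselsTate_pairing (K := ℚ))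
    (W : WeierstrassCurve ℚ) [W.IsElliptic] [W.IsGloballyMinimal] (hCM : W.HasCM) (hram : CMRamified W p) (h5 : 5 ≤ p)
    (hr : W.analyticRank = 1)
    {f : ℕ} [NeZero f] (ψ : DirichletCharacter ℚ_[p] f) (ω : DirichletCharacter ℚ_[p] p) (hω : IsTeichmullerCharacter ω)
    (hss : ∀ ℓ : ℕ, ℓ.Prime → ¬ (ℓ ∣ p * W.conductorNorm ℤ) →
      ‖((W.LFunction ℓ : ℤ) : ℚ_[p]) - (ψ (ℓ : ZMod f) + ψ⁻¹ (ℓ : ZMod f) * ω (ℓ : ZMod p))‖ < 1)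
    (N : ℕ) [NeZero N] (K : Type) [Field K] [NumberField K]
    (Dt : ModularParametrizationData W N) (H : HeegnerDatum N (NumberField.discr K)) (ι : K →+* ℂ)
    (P : (W.baseChange K).toAffine.Point) (Wd : WeierstrassCurve ℚ) [Wd.IsElliptic] [Wd.IsGloballyMinimal]
    (hN : W.conductorNorm ℤ = N) (hK : IsImaginaryQuadratic K) (hHN : SatisfiesHeegnerHypothesis N K)
    (hodd : Odd (NumberField.discr K)) (hd4 : NumberField.discr K < -4)
    (hLt : (W.quadraticTwist (NumberField.discr K : ℚ)).entireLFunction 1 ≠ 0)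
    (hP : WeierstrassCurve.Affine.Point.map ι.toRatAlgHom P = heegnerPointComplex Dt H)
    (hC : ∃ C : VariableChange ℚ, C • W.quadraticTwist (NumberField.discr K : ℚ) = Wd)
    (εK : DirichletCharacter ℚ_[p] (NumberField.discr K).natAbs) (hεK : IsKroneckerCharacterOf K εK)
    (h4 : ¬ ‖bernoulliOnePrim (bernoulliCharOne ψ εK) * bernoulliOnePrim (bernoulliCharTwo ψ εK ω)‖ ≤ (p : ℝ)⁻¹)
    (hWd : BSDp Wd p) :
    BSDp W p ↔ padicValNat p (AddSubgroup.zmultiples P).index = padicValNat p Dt.c.natAbs := by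
  -- move (4) to the class's ODD triple (rigidity of (4) at `(W, p, K)`)
  obtain ⟨f', hf', ψ', ω', εK', -, hψ', hω', hss', -, -, -, hεK'⟩ :=
    OffLocusDictionary.exists_krizLiTriple_odd_of_cmRamified W p hCM hram h5 K hK.1
  haveI := hf'
  have h4' : ¬ ‖bernoulliOnePrim (bernoulliCharOne ψ' εK') * bernoulliOnePrim (bernoulliCharTwo ψ' εK' ω')‖ ≤ (p : ℝ)⁻¹ := by
    rw [← OffLocusDictionary.bernoulliFour_iff_of_hss W h5 K ψ ψ' ω ω' εK εK' hω hω' hss hss' hεK hεK']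
    exact h4
  exact bsdp_iff_heegnerIndex_of_krizLiFour hGZ hKo hGZK hmod hGZ73 hCT W hCM hram h5 hr ψ' ω' hψ' hω' hss' N K Dt H ι P Wd hN hK
    hHN hodd hd4 hLt hP hC εK' hεK' h4' hWd

end Summit.BirchSwinnertonDyer.BirchSwinnertonDyer.Theorems.PrintCFram.ParitySplit

end
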